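import Summits.QuantumFields.BalabanUV.T4Continuum.Support.AveragingDeficitMultiLevelPrep

/-!
# AveragingDeficitMultiLevelFermat (T⁴ programme, node NE3, row NE3-R2, gen 3) — R0 AND R2ᴱ FOR BAŁABAN'S `k`-LEVEL
# COMPOSITE-CONSTRAINT MINIMISERS, EVERY `k`: the constraint map of the `(j+1)`-fold average is a SUBMERSION in the
# chart (strictly differentiable, differential onto the `𝔲(N)` torus fields) by induction on the tower, so
# `AveragingDeficitFermat.fineCritical_of_isLocalMin` applies — the setting of B11 §E (`U_{k+1}` vs `U_k`) in full
# generality (file 2/2 of the multi-level instance of R0)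

HONEST FRAMING (cell `pub-balaban`, T4-DAG PAGE 1; unit `b2b-balaban-t4-ne3r2-p1` = owner of BINDER-OWNERS row NE3-R2,
gen 3).  The cell's T4 target is the finite-torus continuum limit of the unit-scale averaged loop expectations — NOT
infinite volume, NO mass gap, NOT Clay, NOT summit progress.  All [folklore], 0 sorry: §1 **`hasStrictFDerivAt_levelQ`**
(`levelQ j W₁ ∘ chart_id(W₁)` is strictly differentiable at `0` with differential `levelQ' j W₁`, by induction: base =
`contDiffAt_coord` one level up, step = the chain rule through `eventually_cavg_chart_eq'`) and **`levelQ'_onto`** (the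
differential is onto `skewSub M′` from the `𝔲(N)` directions — gen 2's periodic lift `exists_lift_periodic` at every level
of the tower); §2 `continuousAt_cavgIter_chart` (the iterated averages of the chart configuration are continuous in the
chart parameter, any insert); §3 **`fineCritical_multiLevel`** — R0: a `U(N)`-valued `V` of period `L^{j+2}·M′` with
`|V(∂p) − 1| ≤ a < b`, `LevelSmall d L (j+1) b`, minimising the fine Wilson action of the period among the unitary
periodic `U` with `|U(∂p) − 1| ≤ b` and THE SAME `(j+2)`-FOLD AVERAGE `cavgIter L (j+2) U = cavgIter L (j+2) V`, satisfies
`FineCritical L (L·tower j) V (levelQ' j (cavg L V) ∘ res = 0)`; and **`dualResidual_multiLevel`** — gen 2's R2ᴱ-torus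
for such `V` against every periodic coarse `𝔲(N)` direction `φ` with `TangentIter L j (cavg L V) φ` (tangent to the fibre
of the `(j+1)`-fold average, B11's `T = ker DQ̄_k(W_k)`): `L^{d−4}|⟨J(V̄), φ⟩| ≤ wallConst·[‖∇_VF‖_{ℓ²}·dualC2·‖φ‖_{ℓ²} +
a²·dualC1·‖φ‖_{ℓ¹}]`, constants of gen 2, no criticality hypothesis.  `j = 0` is `AveragingDeficitTwoLevelFermat` (up to
the slightly stronger smallness `LevelSmall 1 b`).
WHAT THIS IS NOT: NE3 (ML — tangent coercivity —, (γ2)–(γ4) and the δ-dictionary remain, record `t4/T4-EST-NE3-P2.md` §0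
(e)); existence of minimisers (compactness) is not needed and not claimed; the constants `LevelSmall` are bookkeeping,
not optimised.  NE3 stays COND-free.
CITATION HEADER: no printed sentence is a hypothesis; the manuscripts under audit are not cited for any disputed step;
context: T. Bałaban, Commun. Math. Phys. **98** (1985) 17–51 [Balaban1985Averaging] ((42) p. 23, Prop. 1 p. 24);
**102** (1985) 277–309 [Balaban1985Variational] ((26)–(27) p. 282, (83) p. 290, §E (115)–(121) p. 295, Prop. 6).
PLACEMENT: `Summits/QuantumFields/BalabanUV/` (human rule 2026-08-19).  Record: HOME `t4/T4-EST-NE3-R2.md` v0.4.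
-/

set_option autoImplicit false

open scoped BigOperators Matrix Matrix.Norms.L2Operator Topology
open NormedSpace Finset Filter

namespace Summit.QuantumFields.BalabanUV.T4Continuum.AveragingDeficitMultiLevelFermat

open Literature.MathematicalPhysics.QuantumFieldTheory.Balaban1983to89
open B7Prop1Explicit B7Prop2Explicit MatrixLog UnitaryModel
open T4AveragingDeficitWall hiding Site Plane Plaq Bond
open T4AveragingDeficitWallBoundary (IsPeriodicCfg periodBox)
open T4AveragingDeficitNonAbelian (hol_add_period)
open AveragingDeficitTransport AveragingDeficitPlaqDeriv AveragingDeficitSideDeriv AveragingDeficitPeriodicCounting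
open AveragingDeficitDerivWallProof AveragingDeficitResidualPairing AveragingDeficitFaceWords AveragingDeficitFaceLift
open AveragingDeficitLiftPeriodic
open AveragingDeficitDualResidual AveragingDeficitTorusChart AveragingDeficitChartCalculus AveragingDeficitFermat
open AveragingDeficitTwoLevelPrep AveragingDeficitTwoLevelFermat AveragingDeficitMultiLevelPrep

noncomputable section

variable {d : ℕ} {n : Type*} [Fintype n] [DecidableEq n]

local notation "𝕄" => Matrix n n ℂ
local notation "Site" => B7Prop1Explicit.Site

/-! ## §1 The constraint map in the chart: strict differentiability and surjectivity, by induction on the tower -/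

/-- **`levelQ j W₁ ∘ chart_id(W₁)` IS STRICTLY DIFFERENTIABLE AT `0` WITH DIFFERENTIAL `levelQ' j W₁`** for a unitary
base `W₁` of period `L·tower j` in the small-field class (`LevelSmall j`), by induction: the base is the coordinates of the
second average (`contDiffAt_coord` one level up), the step is the chain rule through
`cavg (chart_id W₁ Φ) = chart_id (cavg W₁) (coord_id W₁ Φ)` (`eventually_cavg_chart_eq'`). [folklore] -/
theorem hasStrictFDerivAt_levelQ [Nonempty n] {L M' : ℕ} [NeZero L] [NeZero M'] (hL : 1 ≤ L) (j : ℕ) :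
    ∀ {W₁ : Site d → Fin d → 𝕄ˣ} {x : ℝ}, IsUnitaryCfg W₁ → IsPeriodicCfg W₁ ((L : ℤ) * (tower L M' j : ℕ)) →
      0 ≤ x → LevelSmall d L j x → SmallField W₁ x →
        HasStrictFDerivAt (fun Φ : TDir d n (L * tower L M' j) =>
          levelQ L M' j W₁ (chart (ContinuousLinearMap.id ℝ 𝕄) (L * tower L M' j) W₁ Φ)) (levelQ' L M' j W₁) 0 := by
  induction j with
  | zero =>
      intro W₁ x hW₁ _ hx hs hW₁x
      have hcoord : HasStrictFDerivAt (coord (ContinuousLinearMap.id ℝ 𝕄) L M' W₁)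
          (fderiv ℝ (coord (ContinuousLinearMap.id ℝ 𝕄) L M' W₁) 0) 0 :=
        (contDiffAt_coord (m := 1) (ContinuousLinearMap.id ℝ 𝕄) L M' W₁
          (ball_of_small hL hW₁ hx hs hW₁x)).hasStrictFDerivAt one_ne_zero
      exact (skewPR (d := d) (n := n) M').hasStrictFDerivAt.comp 0 hcoord
  | succ j ih =>
      intro W₁ x hW₁ hW₁P hx hs hW₁x
      obtain ⟨hlift, hr0, -, -⟩ := smallness_of_twoLevelSmall (d := d) hL hx hs.1
      have h512 := small512_of_liftSmall hL hx hlift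
      have hball := ball_of_small hL hW₁ hx hs.1 hW₁x
      have hW₁P' : IsPeriodicCfg (cavg L W₁) ((L : ℤ) * (tower L M' j : ℕ)) := by
        have h := isPeriodicCfg_cavg L (tower L M' (j + 1)) hW₁P
        rw [natCast_tower_succ] at h
        exact h
      -- the chain: coordinates at `W₁`, then the level-`j` map at `cavg W₁`
      have hcoord : HasStrictFDerivAt (coord (ContinuousLinearMap.id ℝ 𝕄) L (L * tower L M' j) W₁)
          (fderiv ℝ (coord (ContinuousLinearMap.id ℝ 𝕄) L (L * tower L M' j) W₁) 0) 0 :=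
        (contDiffAt_coord (m := 1) (ContinuousLinearMap.id ℝ 𝕄) L (L * tower L M' j) W₁ hball).hasStrictFDerivAt
          one_ne_zero
      have hj := ih (cavg_isUnitaryCfg hL hW₁ hx h512 hW₁x) hW₁P' hr0 hs.2 (smallField_cavg hL hW₁ hx h512 hW₁x)
      rw [← coord_zero (ContinuousLinearMap.id ℝ 𝕄) L (L * tower L M' j) W₁] at hj
      have hcomp := hj.comp 0 hcoord
      have e1 : levelQ' L M' (j + 1) W₁ = (levelQ' L M' j (cavg L W₁)).comp
          (fderiv ℝ (coord (ContinuousLinearMap.id ℝ 𝕄) L (L * tower L M' j) W₁) 0) := rfl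
      rw [e1]
      refine hcomp.congr_of_eventuallyEq ?_
      have hVP : IsPeriodicCfg W₁ ((L : ℤ) * (L * tower L M' j : ℕ)) := hW₁P
      exact (eventually_cavg_chart_eq' (ContinuousLinearMap.id ℝ 𝕄) (M := L * tower L M' j) hVP hball).mono
        fun Φ hΦ => by
          simp only [levelQ_succ, tower]
          rw [hΦ]

/-- **`levelQ' j W₁` IS ONTO `skewSub M′` FROM THE `𝔲(N)` DIRECTIONS** (the submersion of the `(j+1)`-fold average at
`W₁`), by induction: gen 2's periodic lift `exists_lift_periodic` at every level of the tower. [folklore] -/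
theorem levelQ'_onto [Nonempty n] {L M' : ℕ} [NeZero L] [NeZero M'] (hL : 1 ≤ L) (j : ℕ) :
    ∀ {W₁ : Site d → Fin d → 𝕄ˣ} {x : ℝ}, IsUnitaryCfg W₁ → IsPeriodicCfg W₁ ((L : ℤ) * (tower L M' j : ℕ)) →
      0 ≤ x → LevelSmall d L j x → SmallField W₁ x →
        ∀ γ : ↥(skewSub d n M'), ∃ Φ : TDir d n (L * tower L M' j),
          (∀ r κ, Φ r κ ∈ skewAdjoint 𝕄) ∧ levelQ' L M' j W₁ Φ = γ := by
  induction j with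
  | zero =>
      intro W₁ x hW₁ hW₁P hx hs hW₁x γ
      obtain ⟨hlift, -, -, -⟩ := smallness_of_twoLevelSmall (d := d) hL hx hs
      have hball := ball_of_small hL hW₁ hx hs hW₁x
      have hγ : ∀ (r : Fin d → Fin M') (κ : Fin d), (γ : TDir d n M') r κ ∈ skewAdjoint 𝕄 := γ.2
      have hφP : ∀ (y : Site d) (i κ : Fin d), extDir M' (γ : TDir d n M') (y + (M' : ℤ) • e i) κ
          = extDir M' (γ : TDir d n M') y κ := fun y i κ => isPeriodicDir_extDir M' _ y i κ
      obtain ⟨χ, -, hχP, hχpush, -, hχs⟩ :=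
        exists_lift_periodic hL hW₁ hW₁P hx hlift hW₁x (extDir M' (γ : TDir d n M')) hφP
      have hχskew : IsSkewDir χ := hχs fun y κ => hγ _ _
      have hχP' : IsPeriodicDir χ ((L * M' : ℕ) : ℤ) := by rw [natCast_mul_period]; exact hχP
      refine ⟨resDir (L * M') χ, fun r κ => hχskew _ _, ?_⟩
      apply Subtype.ext
      show skewPF M' ((fderiv ℝ (coord (ContinuousLinearMap.id ℝ 𝕄) L M' W₁) 0) (resDir (L * M') χ))
        = (γ : TDir d n M')
      have e : (fderiv ℝ (coord (ContinuousLinearMap.id ℝ 𝕄) L M' W₁) 0) (resDir (L * M') χ) = (γ : TDir d n M') := by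
        funext r κ
        rw [fderiv_coord_apply (ContinuousLinearMap.id ℝ 𝕄) L M' W₁ hball, chartDir_id_resDir (L * M') hχP', hχpush]
        simp only [extDir, redN_boxVec]
      rw [e]
      exact skewPF_of_mem γ.2
  | succ j ih =>
      intro W₁ x hW₁ hW₁P hx hs hW₁x γ
      obtain ⟨hlift, hr0, -, -⟩ := smallness_of_twoLevelSmall (d := d) hL hx hs.1
      have h512 := small512_of_liftSmall hL hx hlift
      have hball := ball_of_small hL hW₁ hx hs.1 hW₁x
      have hW₁P' : IsPeriodicCfg (cavg L W₁) ((L : ℤ) * (tower L M' j : ℕ)) := by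
        have h := isPeriodicCfg_cavg L (tower L M' (j + 1)) hW₁P
        rw [natCast_tower_succ] at h
        exact h
      obtain ⟨Φ₁, hΦ₁s, hΦ₁⟩ := ih (cavg_isUnitaryCfg hL hW₁ hx h512 hW₁x) hW₁P' hr0 hs.2
        (smallField_cavg hL hW₁ hx h512 hW₁x) γ
      -- lift `Φ₁` (a skew field on the torus of period `L·tower j`) through the coordinates at `W₁`
      have hφP : ∀ (y : Site d) (i κ : Fin d), extDir (L * tower L M' j) Φ₁ (y + ((L * tower L M' j : ℕ) : ℤ) • e i) κ
          = extDir (L * tower L M' j) Φ₁ y κ := fun y i κ => isPeriodicDir_extDir (L * tower L M' j) _ y i κ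
      have hW₁PN : IsPeriodicCfg W₁ ((L : ℤ) * (L * tower L M' j : ℕ)) := hW₁P
      obtain ⟨χ, -, hχP, hχpush, -, hχs⟩ :=
        exists_lift_periodic hL hW₁ hW₁PN hx hlift hW₁x (extDir (L * tower L M' j) Φ₁) hφP
      have hχskew : IsSkewDir χ := hχs fun y κ => hΦ₁s _ _
      have hχP' : IsPeriodicDir χ ((L * (L * tower L M' j) : ℕ) : ℤ) := by rw [natCast_mul_period]; exact hχP
      refine ⟨resDir (L * (L * tower L M' j)) χ, fun r κ => hχskew _ _, ?_⟩
      show (levelQ' L M' j (cavg L W₁)).comp (fderiv ℝ (coord (ContinuousLinearMap.id ℝ 𝕄) L (L * tower L M' j) W₁) 0)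
        (resDir (L * (L * tower L M' j)) χ) = γ
      rw [ContinuousLinearMap.comp_apply, ← hΦ₁]
      congr 1
      funext r κ
      rw [fderiv_coord_apply (ContinuousLinearMap.id ℝ 𝕄) L (L * tower L M' j) W₁ hball,
        chartDir_id_resDir (L * (L * tower L M' j)) hχP', hχpush]
      simp only [extDir, redN_boxVec]

/-! ## §2 Continuity of the iterated averages of the chart -/

/-- **The iterated averages of the chart configuration are continuous in the chart parameter at `0`** (any insert `P`),
by induction through `cavg (chart P W Φ) = chart_id (cavg W) (coord P W Φ)` near `0`. [folklore] -/
theorem continuousAt_cavgIter_chart [Nonempty n] {L : ℕ} [NeZero L] (hL : 1 ≤ L) (P₀ : ℕ) [NeZero P₀] (i : ℕ) :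
    ∀ (P : 𝕄 →L[ℝ] 𝕄) {W : Site d → Fin d → 𝕄ˣ} {x : ℝ}, IsUnitaryCfg W →
      IsPeriodicCfg W ((L : ℤ) * (tower L P₀ i : ℕ)) → 0 ≤ x → LevelSmall d L i x → SmallField W x →
        ∀ (y : Site d) (κ : Fin d), ContinuousAt (fun Φ : TDir d n (L * tower L P₀ i) =>
          ((cavgIter L (i + 1) (chart P (L * tower L P₀ i) W Φ) y κ : 𝕄ˣ) : 𝕄)) 0 := by
  induction i with
  | zero =>
      intro P W x hW _ hx hs hWx y κ
      have hball := ball_of_small hL hW hx hs hWx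
      exact (contDiffAt_val_bavg_chart (m := 0) P (L * P₀) W L ((L : ℤ) • y) κ 0
        (by rw [chart_zero]; exact hball _ κ)).continuousAt
  | succ i ih =>
      intro P W x hW hWP hx hs hWx y κ
      obtain ⟨hlift, hr0, -, -⟩ := smallness_of_twoLevelSmall (d := d) hL hx hs.1
      have h512 := small512_of_liftSmall hL hx hlift
      have hball := ball_of_small hL hW hx hs.1 hWx
      have hWP' : IsPeriodicCfg (cavg L W) ((L : ℤ) * (tower L P₀ i : ℕ)) := by
        have h := isPeriodicCfg_cavg L (tower L P₀ (i + 1)) hWP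
        rw [natCast_tower_succ] at h
        exact h
      have hWPN : IsPeriodicCfg W ((L : ℤ) * (L * tower L P₀ i : ℕ)) := hWP
      have hg := ih (ContinuousLinearMap.id ℝ 𝕄) (cavg_isUnitaryCfg hL hW hx h512 hWx) hWP' hr0 hs.2
        (smallField_cavg hL hW hx h512 hWx) y κ
      have hf : ContinuousAt (coord P L (L * tower L P₀ i) W) 0 :=
        (contDiffAt_coord (m := 0) P L (L * tower L P₀ i) W hball).continuousAt
      rw [← coord_zero P L (L * tower L P₀ i) W] at hg
      have hcomp := ContinuousAt.comp (f := coord P L (L * tower L P₀ i) W) hg hf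
      refine hcomp.congr_of_eventuallyEq ?_
      exact (eventually_cavg_chart_eq' P (M := L * tower L P₀ i) hWPN hball).mono fun Φ hΦ => by
        show ((cavgIter L (i + 1) (cavg L (chart P (L * (L * tower L P₀ i)) W Φ)) y κ : 𝕄ˣ) : 𝕄)
          = ((cavgIter L (i + 1) (chart (ContinuousLinearMap.id ℝ 𝕄) (L * tower L P₀ i) (cavg L W)
              (coord P L (L * tower L P₀ i) W Φ)) y κ : 𝕄ˣ) : 𝕄)
        rw [hΦ]

/-! ## §3 R0 and R2ᴱ for honest `(j+2)`-level constrained minimisers -/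

/-- **R0 FOR THE `(j+2)`-LEVEL COMPOSITE AVERAGING CONSTRAINT (all `j`).**  Let `V` be `U(N)`-valued of period
`L·(L·tower L M′ j) = L^{j+2}·M′` with `|V(∂p) − 1| ≤ a`, `0 ≤ a < b`, `LevelSmall d L (j+1) b` (e.g.
`twoLevelSmall·(2L²)^{j+1}·b ≤ 1`, `levelSmall_of_pow`).  If `V` minimises the fine Wilson action of the period among the
`U(N)`-valued `U` of the same period with `|U(∂p) − 1| ≤ b` and THE SAME `(j+2)`-FOLD AVERAGE
`cavgIter L (j+2) U = cavgIter L (j+2) V` (Bałaban's composite constraint `Q̄_{j+2}(U) = V_top`), then `V` is critical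
for the fine action along every periodic face-supported `𝔲(N)` direction whose push-forward is admissible for
`levelQ' j (cavg L V)` — by `levelQ'_resDir_eq_zero`, every direction tangent to the fibre of the `(j+1)`-fold average at
`cavg L V`: `FineCritical L (L·tower L M′ j) V (levelQ' j (cavg L V) ∘ res = 0)`.  Proof: `fineCritical_of_isLocalMin`
with `Q := levelQ L M′ j (cavg L V)` (`hasStrictFDerivAt_levelQ`, `levelQ'_onto`) and the side condition
`|U(∂p) − 1| ≤ b ∧` (top averages relatively within `1/4`) — a chart neighbourhood by `eventually_smallField_chart` and
`continuousAt_cavgIter_chart` — under which the chart constraint decodes to the honest one (`eq_of_skewPR_relLog_eq_zero`,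
`cavgIter_unitary_small`, `isPeriodicCfg_cavgIter`). [cite: Balaban1985Variational, (115)–(121) p.295] -/
theorem fineCritical_multiLevel [Nonempty n] {L M' : ℕ} [NeZero L] [NeZero M'] (j : ℕ) {V : Site d → Fin d → 𝕄ˣ}
    (hV : IsUnitaryCfg V) (hVP : IsPeriodicCfg V ((L : ℤ) * (L * tower L M' j : ℕ))) {a b : ℝ} (ha : 0 ≤ a)
    (hab : a < b) (hb : LevelSmall d L (j + 1) b) (hVa : SmallField V a)
    (hmin : ∀ U : Site d → Fin d → 𝕄ˣ, IsUnitaryCfg U → IsPeriodicCfg U ((L : ℤ) * (L * tower L M' j : ℕ)) →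
      SmallField U b → cavgIter L (j + 2) U = cavgIter L (j + 2) V →
        fineAction V (blockWindow L (periodBox (L * tower L M' j))).2
          ≤ fineAction U (blockWindow L (periodBox (L * tower L M' j))).2) :
    FineCritical L (L * tower L M' j) V (fun φ => levelQ' L M' j (cavg L V) (resDir (L * tower L M' j) φ) = 0) := by
  have hL : 1 ≤ L := Nat.one_le_iff_ne_zero.mpr (NeZero.ne L)
  have hb0 : 0 ≤ b := ha.trans hab.le
  have haS : LevelSmall d L (j + 1) a := LevelSmall.mono ha hab.le hb
  set N : ℕ := L * tower L M' j with hN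
  obtain ⟨hliftA, ha1, -, -⟩ := smallness_of_twoLevelSmall (d := d) hL ha haS.1
  have h512a := small512_of_liftSmall hL ha hliftA
  -- the base `cavg L V` one level up
  have hV₁u : IsUnitaryCfg (cavg L V) := cavg_isUnitaryCfg hL hV ha h512a hVa
  have hV₁P : IsPeriodicCfg (cavg L V) ((L : ℤ) * (tower L M' j : ℕ)) := by
    have h := isPeriodicCfg_cavg L N hVP
    have e : ((N : ℕ) : ℤ) = (L : ℤ) * (tower L M' j : ℕ) := by rw [hN]; push_cast; ring
    rw [e] at h
    exact h
  have hV₁a : SmallField (cavg L V) (prop1Radius d L a) := smallField_cavg hL hV ha h512a hVa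
  haveI : CompleteSpace ↥(skewSub d n M') := FiniteDimensional.complete ℝ _
  have hQ := hasStrictFDerivAt_levelQ (M' := M') hL j hV₁u hV₁P ha1 haS.2 hV₁a
  have hQ' := levelQ'_onto (M' := M') hL j hV₁u hV₁P ha1 haS.2 hV₁a
  -- the top average of `V`
  have hVPt : IsPeriodicCfg V ((tower L M' (j + 2) : ℕ) : ℤ) := by rw [natCast_tower_succ]; exact hVP
  obtain ⟨hXVu, -, -⟩ := cavgIter_unitary_small hL (j + 1) hV ha haS hVa
  have hXVP : IsPeriodicCfg (cavgIter L (j + 2) V) (M' : ℤ) := isPeriodicCfg_cavgIter L M' (j + 2) hVPt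
  -- the side condition: small-field `b` and top averages relatively within `1/4`
  set Near : (Site d → Fin d → 𝕄ˣ) → Prop := fun U => SmallField U b ∧ ∀ (r : Fin d → Fin M') (κ : Fin d),
    ‖(((cavgIter L (j + 2) V (boxVec M' r) κ)⁻¹ : 𝕄ˣ) : 𝕄) * (cavgIter L (j + 2) U (boxVec M' r) κ : 𝕄) - 1‖ ≤ 1 / 4
    with hNear
  have hVP' : IsPeriodicCfg V ((L * N : ℕ) : ℤ) := by rw [natCast_mul_period]; exact hVP
  have hNearE : ∀ᶠ θ in 𝓝 (0 : TDir d n (L * N)), Near (chart skewP (L * N) V θ) := by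
    refine (eventually_smallField_chart skewP (L * N) hVP' hab hVa).and ?_
    refine Filter.eventually_all.mpr fun r => Filter.eventually_all.mpr fun κ => ?_
    have hc0 := continuousAt_cavgIter_chart (d := d) (n := n) hL M' (j + 1) skewP hV hVP ha haS hVa (boxVec M' r) κ
    have hc : ContinuousAt (fun θ : TDir d n (L * N) =>
        ‖(((cavgIter L (j + 2) V (boxVec M' r) κ)⁻¹ : 𝕄ˣ) : 𝕄)
          * ((cavgIter L (j + 2) (chart skewP (L * N) V θ) (boxVec M' r) κ : 𝕄ˣ) : 𝕄) - 1‖) 0 :=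
      ((continuousAt_const.mul hc0).sub continuousAt_const).norm
    have h0 : ‖(((cavgIter L (j + 2) V (boxVec M' r) κ)⁻¹ : 𝕄ˣ) : 𝕄)
        * ((cavgIter L (j + 2) (chart skewP (L * N) V 0) (boxVec M' r) κ : 𝕄ˣ) : 𝕄) - 1‖ < 1 / 4 := by
      rw [chart_zero, Units.inv_mul, sub_self, norm_zero]
      norm_num
    exact (hc.eventually (gt_mem_nhds h0)).mono fun θ hθ => hθ.le
  -- the honest minimality gives the chart-constrained minimality under `Near`
  have hmin' : ∀ U : Site d → Fin d → 𝕄ˣ, IsUnitaryCfg U → IsPeriodicCfg U ((L : ℤ) * N) → Near U →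
      levelQ L M' j (cavg L V) (cavg L U) = levelQ L M' j (cavg L V) (cavg L V) →
        fineAction V (blockWindow L (periodBox N)).2 ≤ fineAction U (blockWindow L (periodBox N)).2 := by
    intro U hU hUP hUN hUQ
    obtain ⟨hUb, hUnear⟩ := hUN
    rw [levelQ_self] at hUQ
    have hUPt : IsPeriodicCfg U ((tower L M' (j + 2) : ℕ) : ℤ) := by rw [natCast_tower_succ]; exact hUP
    obtain ⟨hXUu, -, -⟩ := cavgIter_unitary_small hL (j + 1) hU hb0 hb hUb
    have hXUP : IsPeriodicCfg (cavgIter L (j + 2) U) (M' : ℤ) := isPeriodicCfg_cavgIter L M' (j + 2) hUPt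
    have heq : cavgIter L (j + 2) U = cavgIter L (j + 2) V :=
      eq_of_skewPR_relLog_eq_zero hXVP hXUP hXVu hXUu hUnear hUQ
    exact hmin U hU hUP hUb heq
  exact fineCritical_of_isLocalMin (M := N) hV hVP ha hliftA hVa (levelQ L M' j (cavg L V))
    (levelQ' L M' j (cavg L V)) hQ hQ' Near hNearE hmin'

/-- **R2ᴱ ON THE TORUS FOR HONEST `(j+2)`-LEVEL CONSTRAINED MINIMISERS** (Bałaban's `U_{k+1}` vs `U_k` setting of B11
§E for every number of levels): for `V` as in `fineCritical_multiLevel` and EVERY periodic coarse `𝔲(N)` direction `φ`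
(period `L·tower j`) TANGENT TO THE FIBRE OF THE `(j+1)`-FOLD AVERAGE at `cavg L V` (`TangentIter L j (cavg L V) φ`, B11's
`T = ker DQ̄_k(W_k)`), every coarse field `Φ` agreeing with `φ` at the block corners and every derivative `D_c` at `0` of
`s ↦ A^L(V̄ e^{sΦ})` over the period: `L^{d−4}|D_c| ≤ wallConst·[‖∇_VF‖_{ℓ²(period)}·dualC2·‖φ‖_{ℓ²} + a²·dualC1·‖φ‖_{ℓ¹}]`.
Dictionary: `V = U_{k+1}(V_top)` (`k = j+1`), `V̄ = W_k`, `D_c = ⟨J(W_k), φ⟩`, `φ ∈ T`.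
[cite: Balaban1985Variational, (26)–(27) p.282, §E (115)–(121) p.295] -/
theorem dualResidual_multiLevel [Nonempty n] {L M' : ℕ} [NeZero L] [NeZero M'] (j : ℕ) {V : Site d → Fin d → 𝕄ˣ}
    (hV : IsUnitaryCfg V) (hVP : IsPeriodicCfg V ((L : ℤ) * (L * tower L M' j : ℕ))) {a b : ℝ} (ha : 0 ≤ a)
    (hab : a < b) (hb : LevelSmall d L (j + 1) b) (hVa : SmallField V a)
    (hmin : ∀ U : Site d → Fin d → 𝕄ˣ, IsUnitaryCfg U → IsPeriodicCfg U ((L : ℤ) * (L * tower L M' j : ℕ)) →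
      SmallField U b → cavgIter L (j + 2) U = cavgIter L (j + 2) V →
        fineAction V (blockWindow L (periodBox (L * tower L M' j))).2
          ≤ fineAction U (blockWindow L (periodBox (L * tower L M' j))).2)
    (φ : Site d → Fin d → 𝕄) (hφs : ∀ (y : Site d) (κ : Fin d), φ y κ ∈ skewAdjoint 𝕄)
    (hφP : ∀ (y : Site d) (i κ : Fin d), φ (y + ((L * tower L M' j : ℕ) : ℤ) • e i) κ = φ y κ)
    (hφT : TangentIter L j (cavg L V) φ)
    (Φ : Site d → Fin d → 𝕄) (hΦ : ∀ (y : Site d) (κ : Fin d), Φ ((L : ℤ) • y) κ = φ y κ) {Dc : ℝ}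
    (hDc : HasDerivAt
      (fun s : ℝ => coarseActionOf L (vary (bavg L V) Φ s) (blockWindow L (periodBox (L * tower L M' j))).1) Dc 0) :
    (L : ℝ) ^ ((d : ℤ) - 4) * |Dc|
      ≤ wallConst d L * (Real.sqrt (gradFluxSq V (blockSites L (periodBox (L * tower L M' j))))
            * (dualC2 d L * Real.sqrt (coarseSq (L * tower L M' j) φ))
          + a ^ 2 * (dualC1 d L * coarseL1 (L * tower L M' j) φ)) := by
  have hL : 1 ≤ L := Nat.one_le_iff_ne_zero.mpr (NeZero.ne L)
  have hLN : 1 ≤ L * tower L M' j := Nat.one_le_iff_ne_zero.mpr (Nat.mul_ne_zero (NeZero.ne L) (tower_ne_zero L M' j))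
  have haS : LevelSmall d L (j + 1) a := LevelSmall.mono ha hab.le hb
  obtain ⟨hliftA, ha1, -, -⟩ := smallness_of_twoLevelSmall (d := d) hL ha haS.1
  have h512a := small512_of_liftSmall hL ha hliftA
  have hcrit := fineCritical_multiLevel j hV hVP ha hab hb hVa hmin
  have hV₁P : IsPeriodicCfg (cavg L V) ((L : ℤ) * (tower L M' j : ℕ)) := by
    have h := isPeriodicCfg_cavg L (L * tower L M' j) hVP
    have e : (((L * tower L M' j : ℕ)) : ℤ) = (L : ℤ) * (tower L M' j : ℕ) := by push_cast; ring
    rw [e] at h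
    exact h
  have hφT' : levelQ' L M' j (cavg L V) (resDir (L * tower L M' j) fun y κ => φ y κ) = 0 :=
    levelQ'_resDir_eq_zero hL j (cavg_isUnitaryCfg hL hV ha h512a hVa) hV₁P (prop1Radius_nonneg ha) haS.2
      (smallField_cavg hL hV ha h512a hVa) (fun y i κ => hφP y i κ) hφT
  exact dualResidual_torus hL hLN hV hVP ha hliftA hVa hcrit φ hφs hφP hφT' Φ hΦ hDc

end

end Summit.QuantumFields.BalabanUV.T4Continuum.AveragingDeficitMultiLevelFermat
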